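import Summits.Parity.BatemanHorn.Theorems.AlmostPrimeZerosSystemZeroRepulsionApCharBoundPrincipal

/-!
# The AP tilted majorant, II: the non-principal characters
(crux stmt-Parity-11291, line `smooth-rough-lattice-acquisition`, class `linₐ`, lead c2)

Everything here is PROVED (theorems only).  For a non-principal character `χ mod q` the Dirichlet
series of `a(n) = χ(n) z^{s(n)}` is `F(s) = e^{z ℓ(s)} G(s)` with `ℓ = log L(s, χ)` the branch of
`stub_apLogL` (holomorphic on a classical region `zfr c`, `‖ℓ‖ ≤ log log(|t|+4) + C`) and `G` the
twisted capped Euler product of `stub_apTwistedEulerData` — HOLOMORPHIC on `zfr c'`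
(`c' = min c (log 4/10)`), with `‖F‖ ≤ B (K log(|t|+4))^R`, `K = e^{C}`, `B = e^{b(1+R)^{3/2}}`.  The
pole-free engine `stub_apHolRieszBound` makes both Riesz means `A₁(y)`, `A₁(y+h)` negligible
(`≤ w²(log w)^{−R} e^{−(log log w)³} B`), and `desmooth` gives
`‖Σ_{0<m≤y} χ(m) z^{s(m)}‖ ≤ y (log y)^{Re z − 1} e^{A(1+‖z−1‖)^{3/2}}` — the registered helper stub
**`stub_apCharBoundNonprincipal`** (statements of stubs A, C, D taken as hypotheses, so that the
skeleton composes by name).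

References: H. L. Montgomery, R. C. Vaughan, *Multiplicative Number Theory I*, CUP 2007, §7.4,
§11.1 (Theorems 11.3–11.4), §11.3.
-/

noncomputable section

namespace Summit.Parity.BatemanHorn.Cruxes.SystemZeroRepulsion.NearFar

open scoped BigOperators
open Literature.NumberTheory.LFunctions
open Summit.Parity.BatemanHorn.Cruxes.LinearCappedRepulsion.JensenStieltjesMajorant

/-- Points of the region `zfr c'` with `c' ≤ log 4/10` have `Re s > 9/10`. -/
theorem re_gt_of_mem_zfr {c' : ℝ} (hc' : c' ≤ Real.log 4 / 10) {s : ℂ}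
    (hs : s ∈ ClassicalPsiData.zfr c') : 9 / 10 < s.re := by
  rw [ClassicalPsiData.mem_zfr] at hs
  have h4 : 0 < Real.log 4 := Real.log_pos (by norm_num)
  have hℓ : Real.log 4 ≤ Real.log (|s.im| + 4) :=
    Real.log_le_log (by norm_num) (by linarith [abs_nonneg s.im])
  have hℓ0 : 0 < Real.log (|s.im| + 4) := h4.trans_le hℓ
  have h1 : c' / Real.log (|s.im| + 4) ≤ 1 / 10 := by
    rw [div_le_iff₀ hℓ0]
    linarith
  linarith

/-- `‖e^{zℓ}‖ ≤ (K·ℒ)^R` when `‖z‖ ≤ R`, `‖ℓ‖ ≤ log ℒ + C`, `K = e^{C}`, `ℒ > 0`. -/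
theorem norm_exp_mul_le_rpow {z ℓ : ℂ} {R C ℒ : ℝ} (hzR : ‖z‖ ≤ R) (hℒ : 0 < ℒ)
    (hℓ : ‖ℓ‖ ≤ Real.log ℒ + C) :
    ‖Complex.exp (z * ℓ)‖ ≤ (Real.exp C * ℒ) ^ R := by
  have hR0 : 0 ≤ R := (norm_nonneg z).trans hzR
  have h1 : ‖Complex.exp (z * ℓ)‖ ≤ Real.exp ‖z * ℓ‖ := Complex.norm_exp_le_exp_norm _
  have h2 : ‖z * ℓ‖ ≤ R * (Real.log ℒ + C) := by
    rw [norm_mul]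
    have hC : 0 ≤ Real.log ℒ + C := (norm_nonneg ℓ).trans hℓ
    exact mul_le_mul hzR hℓ (norm_nonneg _) hR0
  have h3 : (Real.exp C * ℒ) ^ R = Real.exp (R * (Real.log ℒ + C)) := by
    rw [Real.mul_rpow (Real.exp_pos C).le hℒ.le, ← Real.exp_mul, Real.rpow_def_of_pos hℒ,
      ← Real.exp_add]
    ring_nf
  rw [h3]
  exact h1.trans (Real.exp_le_exp.2 h2)

/-- **The non-principal characters** (registered helper stub `stub_apCharBoundNonprincipal` of
the crux): given the statements of stubs A (`stub_apTwistedEulerData`), C (`stub_apLogL`) and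
D (`stub_apHolRieszBound`), for every `χ ≠ χ₀ mod q` there are `A ≥ 0`, `C > 0`, `y₀` with
`‖Σ_{0<m≤y} χ(m) z^{s(m)}‖ ≤ y·(log y)^{Re z − 1}·exp(A(1 + ‖z − 1‖)^{3/2})` for all `y ≥ y₀` and all
`z` with `1 + ‖z − 1‖ ≤ log log y / C`. -/
theorem stub_apCharBoundNonprincipal :
    (∀ (q : ℕ) [NeZero q] (χ : DirichletCharacter ℂ q), ∃ b : ℝ, 0 ≤ b ∧ ∀ R : ℝ, 0 ≤ R → ∀ z : ℂ, ‖z‖ ≤ R →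
      ∃ G : ℂ → ℂ, DifferentiableOn ℂ G {s : ℂ | 1 / 2 < s.re} ∧
        (∀ s : ℂ, 4 / 5 < s.re → ‖G s‖ ≤ Real.exp (b * (1 + R) ^ (3 / 2 : ℝ))) ∧
        (∀ σ : ℝ, 1 < σ →
          LSeriesSummable (fun n : ℕ => χ (n : ZMod q) * z ^ (n.factorization.sum fun _ v => min v 2)) σ) ∧
        (∀ s : ℂ, 1 < s.re →
          LSeries (fun n : ℕ => χ (n : ZMod q) * z ^ (n.factorization.sum fun _ v => min v 2)) s =
            Complex.exp (z * ∑' p : Nat.Primes, -Complex.log (1 - χ ((p : ℕ) : ZMod q) * ((p : ℕ) : ℂ) ^ (-s))) * G s) ∧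
        (∀ σ : ℝ, 1 < σ → σ ≤ 2 →
          ∑' n : ℕ, ‖LSeries.term (fun n : ℕ => χ (n : ZMod q) * z ^ (n.factorization.sum fun _ v => min v 2)) σ n‖ ≤
            Real.exp (b * (1 + R) ^ (3 / 2 : ℝ)) / (σ - 1) ^ R) ∧
        (χ = 1 → Literature.NumberTheory.LFunctions.SelbergDelange.RieszData R (4 / 5) (Real.exp (b * (1 + R) ^ (3 / 2 : ℝ))) z
          (fun n : ℕ => χ (n : ZMod q) * z ^ (n.factorization.sum fun _ v => min v 2))
          (fun s : ℂ => G s * Complex.exp (z * ∑ p ∈ q.primeFactors, Complex.log (1 - ((p : ℕ) : ℂ) ^ (-s)))))) →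
    (∀ (q : ℕ) [NeZero q] (χ : DirichletCharacter ℂ q), χ ≠ 1 → ∃ c : ℝ, 0 < c ∧ ∃ C : ℝ, 0 ≤ C ∧ ∃ ℓ : ℂ → ℂ,
      DifferentiableOn ℂ ℓ (Literature.NumberTheory.LFunctions.ClassicalPsiData.zfr c) ∧
      (∀ s ∈ Literature.NumberTheory.LFunctions.ClassicalPsiData.zfr c, ‖ℓ s‖ ≤ Real.log (Real.log (|s.im| + 4)) + C) ∧
      (∀ s : ℂ, 1 < s.re →
        ℓ s = ∑' p : Nat.Primes, -Complex.log (1 - χ ((p : ℕ) : ZMod q) * ((p : ℕ) : ℂ) ^ (-s)))) →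
    (∀ (c K : ℝ), 0 < c → 1 ≤ K → ∃ X₀ : ℝ, ∀ (R B : ℝ) (a : ℕ → ℂ) (F : ℂ → ℂ), 1 ≤ R → 0 ≤ B →
      DifferentiableOn ℂ F (Literature.NumberTheory.LFunctions.ClassicalPsiData.zfr c) →
      (∀ s ∈ Literature.NumberTheory.LFunctions.ClassicalPsiData.zfr c, ‖F s‖ ≤ B * (K * Real.log (|s.im| + 4)) ^ R) →
      (∀ σ : ℝ, 1 < σ → LSeriesSummable a σ) →
      (∀ s : ℂ, 1 < s.re → LSeries a s = F s) →
      (∀ σ : ℝ, 1 < σ → σ ≤ 2 → ∑' n : ℕ, ‖LSeries.term a σ n‖ ≤ B / (σ - 1) ^ R) →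
      ∀ x : ℝ, X₀ ≤ x → R ≤ Real.log (Real.log x) →
        ‖∑ n ∈ Finset.Ioc 0 ⌊x⌋₊, a n * ((x : ℂ) - n)‖ ≤
          x ^ 2 * Real.log x ^ (-R) * Real.exp (-(Real.log (Real.log x)) ^ 3) * B) →
    ∀ (q : ℕ) [NeZero q] (χ : DirichletCharacter ℂ q), χ ≠ 1 →
      ∃ A : ℝ, 0 ≤ A ∧ ∃ C : ℝ, 0 < C ∧ ∃ y₀ : ℕ, ∀ y : ℕ, y₀ ≤ y → ∀ z : ℂ,
        1 + ‖z - 1‖ ≤ Real.log (Real.log y) / C →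
        ‖∑ n ∈ Finset.Ioc 0 y, χ (n : ZMod q) * z ^ (n.factorization.sum fun _ v => min v 2)‖ ≤
          (y : ℝ) * Real.log y ^ (z.re - 1) * Real.exp (A * (1 + ‖z - 1‖) ^ (3 / 2 : ℝ)) := by
  intro hA hC hD q _ χ hχ
  obtain ⟨b, hb0, hEul⟩ := hA q χ
  obtain ⟨cχ, hcχ, Cχ, hCχ0, ℓ, hℓdiff, hℓbd, hℓeq⟩ := hC q χ hχ
  -- the region constant and the engine threshold
  set c' : ℝ := min cχ (Real.log 4 / 10) with hc'def
  have h4 : 0 < Real.log 4 := Real.log_pos (by norm_num)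
  have hc' : 0 < c' := lt_min hcχ (by positivity)
  have hc'χ : c' ≤ cχ := min_le_left _ _
  have hc'4 : c' ≤ Real.log 4 / 10 := min_le_right _ _
  set K : ℝ := Real.exp Cχ with hKdef
  have hK1 : 1 ≤ K := Real.one_le_exp hCχ0
  obtain ⟨X₀, hHol⟩ := hD c' K hc' hK1
  obtain ⟨Br, hBr0, hrank⟩ := stub_rankinMajorant
  obtain ⟨C₁, hC₁, x₁, hshort⟩ := stub_shortIntervalCapped Br hBr0 hrank
  -- constants
  set C : ℝ := max C₁ 1 with hCdef
  have hC1 : (1 : ℝ) ≤ C := le_max_right _ _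
  have hCC₁ : C₁ ≤ C := le_max_left _ _
  have hC : 0 < C := by linarith
  set A : ℝ := 3 * b + 5 with hAdef
  have hA0 : 0 ≤ A := by rw [hAdef]; positivity
  set y₀ : ℕ := max (max x₁ ⌈X₀⌉₊) 3 with hy₀def
  refine ⟨A, hA0, C, hC, y₀, fun y hy z hz => ?_⟩
  -- unpacking the threshold
  have hx₁ : x₁ ≤ y := le_trans ((le_max_left _ _).trans (le_max_left _ _)) hy
  have hX₀ : X₀ ≤ (y : ℝ) :=
    (Nat.le_ceil X₀).trans (by exact_mod_cast ((le_max_right _ _).trans (le_max_left _ _)).trans hy)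
  have hy3 : (3 : ℕ) ≤ y := le_trans (le_max_right _ _) hy
  have hypos : (0 : ℝ) < y := by exact_mod_cast (show 0 < y by omega)
  set 𝓛 : ℝ := Real.log y with h𝓛def
  set L : ℝ := Real.log 𝓛 with hLdef
  have h𝓛1 : 1 ≤ 𝓛 := by
    rw [h𝓛def, Real.le_log_iff_exp_le hypos]
    have h3 : (3 : ℝ) ≤ y := by exact_mod_cast hy3
    exact (Real.exp_one_lt_d9.le.trans (by norm_num)).trans h3
  have h𝓛pos : 0 < 𝓛 := by linarith
  -- the radius
  set r : ℝ := ‖z - 1‖ with hrdef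
  have hr0 : 0 ≤ r := norm_nonneg _
  set R : ℝ := 1 + r with hRdef
  have hR1 : 1 ≤ R := by rw [hRdef]; linarith
  have hR0 : 0 ≤ R := by linarith
  have hzR : ‖z‖ ≤ R := by
    have h := norm_add_le (z - 1) 1
    simp only [sub_add_cancel, norm_one] at h
    rw [hRdef, hrdef]; linarith
  have hRLC : R ≤ L / C := hz
  have hLC : C ≤ L := by
    have h1 : 1 ≤ L / C := hR1.trans hRLC
    rwa [le_div_iff₀ hC, one_mul] at h1
  have hL0 : 0 < L := hC.trans_le hLC
  have hRL : R ≤ L := hRLC.trans (div_le_self hL0.le hC1)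
  have hRC₁ : R ≤ L / C₁ := hRLC.trans (div_le_div_of_nonneg_left hL0.le hC₁ hCC₁)
  have hrez' : -r ≤ z.re - 1 := by
    have h1 : |(z - 1).re| ≤ ‖z - 1‖ := Complex.abs_re_le_norm _
    have h2 : (z - 1).re = z.re - 1 := by simp
    rw [h2] at h1
    rw [hrdef]
    linarith [neg_abs_le (z.re - 1)]
  have hrez : -R ≤ z.re - 1 := by rw [hRdef]; linarith
  -- the data: `F = e^{zℓ} G`
  obtain ⟨G, hGdiff, hGbd, hsum, hLser, hmaj, -⟩ := hEul R hR0 z hzR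
  set B : ℝ := Real.exp (b * (1 + R) ^ (3 / 2 : ℝ)) with hBdef
  have hB0 : 0 ≤ B := (Real.exp_pos _).le
  set sfun : ℕ → ℕ := fun n => n.factorization.sum fun _ v => min v 2 with hsfun
  set a : ℕ → ℂ := fun n => χ (n : ZMod q) * z ^ sfun n with hadef
  set F : ℂ → ℂ := fun s => Complex.exp (z * ℓ s) * G s with hFdef
  have hzfr : ∀ s ∈ ClassicalPsiData.zfr c', s ∈ ClassicalPsiData.zfr cχ ∧ 9 / 10 < s.re :=
    fun s hs => ⟨ClassicalPsiData.zfr_mono hc'χ hs, re_gt_of_mem_zfr hc'4 hs⟩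
  have hFdiff : DifferentiableOn ℂ F (ClassicalPsiData.zfr c') := by
    intro s hs
    obtain ⟨hs1, hre⟩ := hzfr s hs
    have h1 : DifferentiableAt ℂ ℓ s :=
      hℓdiff.differentiableAt ((ClassicalPsiData.isOpen_zfr cχ).mem_nhds hs1)
    have h2 : DifferentiableAt ℂ G s :=
      hGdiff.differentiableAt ((isOpen_lt continuous_const Complex.continuous_re).mem_nhds
        (show 1 / 2 < s.re by linarith))
    exact (((differentiableAt_const z).mul h1).cexp.mul h2).differentiableWithinAt
  have hFbd : ∀ s ∈ ClassicalPsiData.zfr c', ‖F s‖ ≤ B * (K * Real.log (|s.im| + 4)) ^ R := by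
    intro s hs
    obtain ⟨hs1, hre⟩ := hzfr s hs
    have hℒ : 0 < Real.log (|s.im| + 4) :=
      h4.trans_le (Real.log_le_log (by norm_num) (by linarith [abs_nonneg s.im]))
    have h1 := norm_exp_mul_le_rpow hzR hℒ (hℓbd s hs1)
    have h2 := hGbd s (by linarith)
    rw [hFdef]
    simp only [norm_mul]
    calc ‖Complex.exp (z * ℓ s)‖ * ‖G s‖ ≤ (Real.exp Cχ * Real.log (|s.im| + 4)) ^ R * B :=
          mul_le_mul h1 h2 (norm_nonneg _) (by positivity)
      _ = B * (K * Real.log (|s.im| + 4)) ^ R := by rw [hKdef, mul_comm]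
  have hLeq : ∀ s : ℂ, 1 < s.re → LSeries a s = F s := by
    intro s hs
    rw [hadef, hFdef]
    simp only
    rw [hLser s hs, ← hℓeq s hs]
  have hHolx := hHol R B a F hR1 hB0 hFdiff hFbd (by simpa [hadef, hsfun] using hsum) hLeq
    (by simpa [hadef, hsfun] using hmaj)
  -- the two Riesz means are negligible
  set h : ℝ := (y : ℝ) * Real.exp (-(Real.log (Real.log y) ^ 3)) with hhdef
  have hhpos : 0 < h := mul_pos hypos (Real.exp_pos _)
  have hhx : h ≤ y := by
    have : Real.exp (-(Real.log (Real.log y) ^ 3)) ≤ 1 := by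
      rw [Real.exp_le_one_iff, neg_nonpos]; positivity
    calc h = (y : ℝ) * Real.exp (-(Real.log (Real.log y) ^ 3)) := rfl
      _ ≤ (y : ℝ) * 1 := by gcongr
      _ = y := mul_one _
  have hyh : (y : ℝ) ≤ y + h := by linarith
  have hlogyh : 𝓛 ≤ Real.log ((y : ℝ) + h) := Real.log_le_log hypos hyh
  have hLyh : L ≤ Real.log (Real.log ((y : ℝ) + h)) := Real.log_le_log h𝓛pos hlogyh
  have hA1 := hHolx ((y : ℝ) + h) (hX₀.trans hyh) (hRL.trans hLyh)
  have hA0' := hHolx (y : ℝ) hX₀ hRL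
  -- their bounds: `≤ 4 y h 𝓛^{−R} B` and `≤ y h 𝓛^{−R} B`
  have h𝓛R : 0 < 𝓛 ^ (-R) := Real.rpow_pos_of_pos h𝓛pos _
  have hbd1 : ((y : ℝ) + h) ^ 2 * Real.log ((y : ℝ) + h) ^ (-R) *
      Real.exp (-(Real.log (Real.log ((y : ℝ) + h))) ^ 3) * B ≤ 4 * (y * h * 𝓛 ^ (-R) * B) := by
    have e1 : ((y : ℝ) + h) ^ 2 ≤ 4 * (y : ℝ) ^ 2 := by nlinarith
    have e2 : Real.log ((y : ℝ) + h) ^ (-R) ≤ 𝓛 ^ (-R) :=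
      Real.rpow_le_rpow_of_nonpos h𝓛pos hlogyh (by linarith)
    have e3 : Real.exp (-(Real.log (Real.log ((y : ℝ) + h))) ^ 3) ≤ Real.exp (-L ^ 3) := by
      rw [Real.exp_le_exp, neg_le_neg_iff]
      exact pow_le_pow_left₀ hL0.le hLyh 3
    have e4 : (y : ℝ) ^ 2 * Real.exp (-L ^ 3) = y * h := by rw [hhdef, hLdef, h𝓛def]; ring
    have e5 : 0 ≤ Real.log ((y : ℝ) + h) ^ (-R) := Real.rpow_nonneg (by linarith) _
    calc ((y : ℝ) + h) ^ 2 * Real.log ((y : ℝ) + h) ^ (-R) *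
          Real.exp (-(Real.log (Real.log ((y : ℝ) + h))) ^ 3) * B
        ≤ (4 * (y : ℝ) ^ 2) * 𝓛 ^ (-R) * Real.exp (-L ^ 3) * B := by gcongr
      _ = 4 * (y * h * 𝓛 ^ (-R) * B) := by rw [← e4]; ring
  have hbd0 : (y : ℝ) ^ 2 * Real.log (y : ℝ) ^ (-R) * Real.exp (-(Real.log (Real.log (y : ℝ))) ^ 3) * B =
      y * h * 𝓛 ^ (-R) * B := by rw [hhdef]; ring
  -- de-smoothing
  have ha : ∀ n, ‖a n‖ ≤ R ^ sfun n := by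
    intro n
    rw [hadef]
    simp only [norm_mul, norm_pow]
    calc ‖χ (n : ZMod q)‖ * ‖z‖ ^ sfun n ≤ 1 * R ^ sfun n :=
          mul_le_mul (DirichletCharacter.norm_le_one _ _) (pow_le_pow_left₀ (norm_nonneg _) hzR _)
            (by positivity) zero_le_one
      _ = R ^ sfun n := one_mul _
  have hdiff : ‖(∑ n ∈ Finset.Ioc 0 ⌊(y : ℝ) + h⌋₊, a n * ((((y : ℝ) + h : ℝ) : ℂ) - n)) -
      ∑ n ∈ Finset.Ioc 0 ⌊(y : ℝ)⌋₊, a n * (((y : ℝ) : ℂ) - n)‖ ≤ 5 * (y * h * 𝓛 ^ (-R) * B) := by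
    refine (norm_sub_le _ _).trans ?_
    have := add_le_add (hA1.trans hbd1) (le_of_eq hbd0 |>.trans' hA0')
    linarith
  have hShortx := hshort y hx₁ R hR1 hRC₁
  have hdes := desmooth ha hhpos hdiff (S₁ := (y : ℝ) * 𝓛 ^ (-R - 1))
    (by simpa [hhdef, hsfun] using hShortx)
  -- hence the bound for A(y)
  have h𝓛mono : 𝓛 ^ (-R - 1) ≤ 𝓛 ^ (z.re - 1) :=
    Real.rpow_le_rpow_of_exponent_le h𝓛1 (by linarith)
  have h𝓛mono' : 𝓛 ^ (-R) ≤ 𝓛 ^ (z.re - 1) :=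
    Real.rpow_le_rpow_of_exponent_le h𝓛1 (by linarith)
  have hAx : ‖∑ n ∈ Finset.Ioc 0 y, a n‖ ≤ (y : ℝ) * 𝓛 ^ (z.re - 1) * (5 * B + 1) := by
    have h3 : h * ‖∑ n ∈ Finset.Ioc 0 y, a n‖ ≤ h * ((y : ℝ) * 𝓛 ^ (z.re - 1) * (5 * B + 1)) := by
      calc h * ‖∑ n ∈ Finset.Ioc 0 y, a n‖
          ≤ 5 * (y * h * 𝓛 ^ (-R) * B) + h * ((y : ℝ) * 𝓛 ^ (-R - 1)) := hdes
        _ ≤ 5 * (y * h * 𝓛 ^ (z.re - 1) * B) + h * ((y : ℝ) * 𝓛 ^ (z.re - 1)) := by gcongr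
        _ = h * ((y : ℝ) * 𝓛 ^ (z.re - 1) * (5 * B + 1)) := by ring
    exact le_of_mul_le_mul_left h3 hhpos
  -- the constant: `5B + 1 ≤ exp(A R^{3/2})`
  have hexpA : 5 * B + 1 ≤ Real.exp (A * (1 + r) ^ (3 / 2 : ℝ)) := by
    rw [hBdef, ← hRdef]
    have h1 : (1 : ℝ) ≤ R ^ (3 / 2 : ℝ) := Real.one_le_rpow hR1 (by norm_num)
    have h2 := one_add_rpow_three_halves_le hR1
    have h3 : b * (1 + R) ^ (3 / 2 : ℝ) ≤ 3 * b * R ^ (3 / 2 : ℝ) := by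
      have := mul_le_mul_of_nonneg_left h2 hb0
      linarith
    have h5 := mul_exp_add_one_le (u := 3 * b * R ^ (3 / 2 : ℝ)) (K := 5) (by positivity)
    have h6 : 3 * b * R ^ (3 / 2 : ℝ) + 5 ≤ A * R ^ (3 / 2 : ℝ) := by
      rw [hAdef]
      have : (3 * b + 5) * R ^ (3 / 2 : ℝ) = 3 * b * R ^ (3 / 2 : ℝ) + 5 * R ^ (3 / 2 : ℝ) := by ring
      linarith
    calc 5 * Real.exp (b * (1 + R) ^ (3 / 2 : ℝ)) + 1
        ≤ 5 * Real.exp (3 * b * R ^ (3 / 2 : ℝ)) + 1 := by gcongr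
      _ ≤ Real.exp (3 * b * R ^ (3 / 2 : ℝ) + 5) := h5
      _ ≤ Real.exp (A * R ^ (3 / 2 : ℝ)) := Real.exp_le_exp.2 h6
  have hmain : (y : ℝ) * 𝓛 ^ (z.re - 1) * (5 * B + 1) ≤
      (y : ℝ) * 𝓛 ^ (z.re - 1) * Real.exp (A * (1 + r) ^ (3 / 2 : ℝ)) := by
    have : 0 ≤ (y : ℝ) * 𝓛 ^ (z.re - 1) := by positivity
    exact mul_le_mul_of_nonneg_left hexpA this
  exact hAx.trans hmain

end Summit.Parity.BatemanHorn.Cruxes.SystemZeroRepulsion.NearFar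

end
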